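import Summits.ValiantsHypothesis.ValiantsHypothesis.Theorems.KPlusLogSqLawStaticPathHighTips
import Summits.ValiantsHypothesis.ValiantsHypothesis.Theorems.KPlusLogSqLawStaticPathLowTipsSteps

/-!
# Route «KPlusLogSqLaw» — parametric max-weight independent set on a path: THEOREM T′ mirrored, the λ-high tips — no bad line at the bottom candidate

HONEST FRAMING.  Helper toward the crux `WeakLifting` (item `stmt-ValiantsHypothesis-19561`, route `KPlusLogSqLaw`, cell `pub-symmetroid`,
seat val-sym-lift-p4 g21, 2026-08-29) on the line of its witness-plan stub `stub_tridiagonalSectorB` (tropical twin of the STATIC tridiagonal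
sector = parametric maximum-weight independent set on a path).  Mirror image of `…StaticPathLowTipsSteps` for the λ-HIGH tips (even–even half of
THEOREM T′, THEOREM-T.md §4): at the vertex of a λ-high-type pair — (I*) two ceilings whose slopes straddle `λ`, (II*) a ceiling of slope `< λ` and
a flatter floor, (III*) a ceiling of slope `> λ` flatter than the floor — if every λ-high-type pair formed from the pair's lines and a third line `t`
has functional value `y - λθ` at LEAST the pair's and some point is weakly on the correct side of the pair's lines and of `t`, then `t` is not
strictly incorrect at the vertex (`noBadHigh_typeI/II/III`).  Sign algebra only.  Statements about a labelled line arrangement; nothing here asserts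
anything about `WeakLifting`, `TropicalB`, `KPlusLogSqLaw`, the stub in its window, `MatrixDescartes` (stmt-ValiantsHypothesis-18050) or `VP ≠ VNP`.
-/

set_option linter.dupNamespace false
set_option autoImplicit false

namespace Summit.ValiantsHypothesis.ValiantsHypothesis.Theorems.KPlusLogSqLaw

open Finset Classical

namespace StaticPathFold

noncomputable section

variable (a b : ℕ → ℝ)

section HighTips

variable (lam : ℝ) (S : ℕ → ℕ → Prop)

/-- type I* step: at the top corner of two ceilings `e₁, e₂` whose slopes straddle `λ`, if every λ-high-type pair among `t, e₁, e₂` has functional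
value at least that of `(e₁, e₂)` and some point is weakly correct for `e₁, e₂, t`, then `t` is not strictly incorrect at the vertex. [folklore] -/
theorem noBadHigh_typeI
    (hS : ∀ p q, S p q ↔
      ((Even p ∧ Even q ∧ ((a p < lam ∧ lam < a q) ∨ (a q < lam ∧ lam < a p))) ∨
       (Odd (p + q) ∧ (if Even p then a q < a p else a p < a q) ∧ (if Even p then a p else a q) < lam) ∨
       (Odd (p + q) ∧ (if Even p then a p < a q else a q < a p) ∧ lam < (if Even p then a p else a q))))
    {e₁ e₂ t : ℕ} (he₁ : Even e₁) (he₂ : Even e₂) (h1 : a e₁ < lam) (h2 : lam < a e₂)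
    (hAt₁ : a t ≠ a e₁) (hAt₂ : a t ≠ a e₂) (hlt : a t ≠ lam)
    (hbad : (Even t ∧ L a b t ((b e₂ - b e₁) / (a e₁ - a e₂)) < L a b e₁ ((b e₂ - b e₁) / (a e₁ - a e₂))) ∨
      (¬ Even t ∧ L a b e₁ ((b e₂ - b e₁) / (a e₁ - a e₂)) < L a b t ((b e₂ - b e₁) / (a e₁ - a e₂))))
    (hmin : ∀ x y, (x = t ∨ x = e₁ ∨ x = e₂) → (y = t ∨ y = e₁ ∨ y = e₂) → S x y →
      L a b e₁ ((b e₂ - b e₁) / (a e₁ - a e₂)) - lam * ((b e₂ - b e₁) / (a e₁ - a e₂)) ≤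
        L a b x ((b y - b x) / (a x - a y)) - lam * ((b y - b x) / (a x - a y)))
    (hwit : ∃ θ' y', y' ≤ L a b e₁ θ' ∧ y' ≤ L a b e₂ θ' ∧ (Even t → y' ≤ L a b t θ') ∧ (¬ Even t → L a b t θ' ≤ y')) :
    False := by
  set τ₀ := (b e₂ - b e₁) / (a e₁ - a e₂) with hτ₀
  have hA : a e₁ ≠ a e₂ := ne_of_lt (h1.trans h2)
  have hy : L a b e₂ τ₀ = L a b e₁ τ₀ := L_eq_L_crossAbs a b hA
  rcases hbad with ⟨hte, hb⟩ | ⟨hto, hb⟩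
  · -- a ceiling below the vertex
    rcases lt_or_gt_of_ne hlt with hl | hg
    · -- flatter than `λ`: the top corner `(t, e₂)` is a lower candidate
      have hSt : S t e₂ := (hS t e₂).mpr (Or.inl ⟨hte, he₂, Or.inl ⟨hl, h2⟩⟩)
      have hm := hmin t e₂ (Or.inl rfl) (Or.inr (Or.inr rfl)) hSt
      have hlt₂ : a t < a e₂ := hl.trans h2
      have hcr : (b e₂ - b t) / (a t - a e₂) < τ₀ := (L_lt_L_iff_crossAbs_lt a b hlt₂ τ₀).mp (by rw [hy]; exact hb)
      have e1 : L a b t ((b e₂ - b t) / (a t - a e₂)) = L a b e₂ ((b e₂ - b t) / (a t - a e₂)) :=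
        (L_eq_L_crossAbs a b (ne_of_lt hlt₂)).symm
      rw [e1] at hm
      have e2 := phi_along a b lam e₂ τ₀ ((b e₂ - b t) / (a t - a e₂))
      have : 0 < (a e₂ - lam) * (τ₀ - (b e₂ - b t) / (a t - a e₂)) := mul_pos (by linarith) (by linarith)
      linarith
    · -- steeper than `λ`: the top corner `(e₁, t)` is a lower candidate
      have hSt : S e₁ t := (hS e₁ t).mpr (Or.inl ⟨he₁, hte, Or.inl ⟨h1, hg⟩⟩)
      have hm := hmin e₁ t (Or.inr (Or.inl rfl)) (Or.inl rfl) hSt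
      have hlt₁ : a e₁ < a t := h1.trans hg
      have hcr : τ₀ < (b t - b e₁) / (a e₁ - a t) := (L_lt_L_iff_lt_crossAbs a b hlt₁ τ₀).mp hb
      have e2 := phi_along a b lam e₁ τ₀ ((b t - b e₁) / (a e₁ - a t))
      have : 0 < (lam - a e₁) * ((b t - b e₁) / (a e₁ - a t) - τ₀) := mul_pos (by linarith) (by linarith)
      linarith
  · -- a floor above the vertex
    rcases lt_or_gt_of_ne hAt₂ with hlt₂ | hgt₂
    · rcases lt_or_gt_of_ne hAt₁ with hlt₁ | hgt₁
      · -- flatter than `e₁`: the left tip `(t, e₁)` is a lower candidate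
        have hSt : S t e₁ := (hS t e₁).mpr (Or.inr (Or.inl ⟨by
          rw [Nat.odd_add']; exact ⟨fun h => absurd he₁ (Nat.not_even_iff_odd.mpr h), fun h => absurd h hto⟩,
          by rw [if_neg hto]; exact hlt₁, by rw [if_neg hto]; exact h1⟩))
        have hm := hmin t e₁ (Or.inl rfl) (Or.inr (Or.inl rfl)) hSt
        have hcr : τ₀ < (b e₁ - b t) / (a t - a e₁) := (L_lt_L_iff_lt_crossAbs a b hlt₁ τ₀).mp hb
        have e1 : L a b t ((b e₁ - b t) / (a t - a e₁)) = L a b e₁ ((b e₁ - b t) / (a t - a e₁)) :=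
          (L_eq_L_crossAbs a b (ne_of_lt hlt₁)).symm
        rw [e1] at hm
        have e2 := phi_along a b lam e₁ τ₀ ((b e₁ - b t) / (a t - a e₁))
        have : 0 < (lam - a e₁) * ((b e₁ - b t) / (a t - a e₁) - τ₀) := mul_pos (by linarith) (by linarith)
        linarith
      · -- slope strictly between: no point is weakly correct for `e₁, e₂, t`
        obtain ⟨θ', y', c1, c2, -, c4⟩ := hwit
        have c4' := c4 hto
        have f1 := L_eq_L_add_mul a b e₁ τ₀ θ'
        have f2 := L_eq_L_add_mul a b e₂ τ₀ θ'
        have f3 := L_eq_L_add_mul a b t τ₀ θ'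
        rcases le_or_gt τ₀ θ' with hθ | hθ
        · nlinarith [mul_nonneg (sub_nonneg.mpr hgt₁.le) (sub_nonneg.mpr hθ)]
        · nlinarith [mul_nonneg_of_nonpos_of_nonpos (sub_nonpos.mpr hlt₂.le) (sub_nonpos.mpr hθ.le)]
    · -- steeper than `e₂`: the right tip `(e₂, t)` is a lower candidate
      have hSt : S e₂ t := (hS e₂ t).mpr (Or.inr (Or.inr ⟨by
        rw [Nat.odd_add]; exact ⟨fun h => absurd he₂ (Nat.not_even_iff_odd.mpr h), fun h => absurd h hto⟩,
        by rw [if_pos he₂]; exact hgt₂, by rw [if_pos he₂]; exact h2⟩))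
      have hm := hmin e₂ t (Or.inr (Or.inr rfl)) (Or.inl rfl) hSt
      have hcr : (b t - b e₂) / (a e₂ - a t) < τ₀ := (L_lt_L_iff_crossAbs_lt a b hgt₂ τ₀).mp (by rw [hy]; exact hb)
      have e2 := phi_along a b lam e₂ τ₀ ((b t - b e₂) / (a e₂ - a t))
      have : 0 < (a e₂ - lam) * (τ₀ - (b t - b e₂) / (a e₂ - a t)) := mul_pos (by linarith) (by linarith)
      have e3 : L a b e₁ τ₀ - lam * τ₀ = L a b e₂ τ₀ - lam * τ₀ := by rw [hy]
      linarith

/-- type II* step: at the vertex of a ceiling `e` of slope `< λ` and a flatter floor `o` (a left tip), if every λ-high-type pair among `t, e, o` has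
functional value at least that of `(e, o)` and some point is weakly correct for `e, o, t`, then `t` is not strictly incorrect at the vertex. [folklore] -/
theorem noBadHigh_typeII
    (hS : ∀ p q, S p q ↔
      ((Even p ∧ Even q ∧ ((a p < lam ∧ lam < a q) ∨ (a q < lam ∧ lam < a p))) ∨
       (Odd (p + q) ∧ (if Even p then a q < a p else a p < a q) ∧ (if Even p then a p else a q) < lam) ∨
       (Odd (p + q) ∧ (if Even p then a p < a q else a q < a p) ∧ lam < (if Even p then a p else a q))))
    {e o t : ℕ} (he : Even e) (ho : ¬ Even o) (hs : a o < a e) (hl : a e < lam)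
    (hAte : a t ≠ a e) (hAto : a t ≠ a o) (hlt : a t ≠ lam)
    (hbad : (Even t ∧ L a b t ((b o - b e) / (a e - a o)) < L a b e ((b o - b e) / (a e - a o))) ∨
      (¬ Even t ∧ L a b e ((b o - b e) / (a e - a o)) < L a b t ((b o - b e) / (a e - a o))))
    (hmin : ∀ x y, (x = t ∨ x = e ∨ x = o) → (y = t ∨ y = e ∨ y = o) → S x y →
      L a b e ((b o - b e) / (a e - a o)) - lam * ((b o - b e) / (a e - a o)) ≤
        L a b x ((b y - b x) / (a x - a y)) - lam * ((b y - b x) / (a x - a y)))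
    (hwit : ∃ θ' y', y' ≤ L a b e θ' ∧ L a b o θ' ≤ y' ∧ (Even t → y' ≤ L a b t θ') ∧ (¬ Even t → L a b t θ' ≤ y')) :
    False := by
  set τ₀ := (b o - b e) / (a e - a o) with hτ₀
  have hA : a e ≠ a o := ne_of_gt hs
  have hy : L a b o τ₀ = L a b e τ₀ := L_eq_L_crossAbs a b hA
  have hτ₀' : τ₀ = (b e - b o) / (a o - a e) := by rw [hτ₀]; exact crossAbs_symm a b e o
  rcases hbad with ⟨hte, hb⟩ | ⟨hto, hb⟩
  · -- a ceiling below the vertex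
    rcases lt_or_gt_of_ne hAto with hlt' | hgt'
    · -- flatter than the floor: no point is weakly correct for `e, o, t`
      obtain ⟨θ', y', c1, c2, c3, -⟩ := hwit
      have c3' := c3 hte
      have hθ : τ₀ ≤ θ' := by rw [hτ₀']; exact (L_le_L_iff_crossAbs_le a b hs θ').mp (c2.trans c1)
      have f2 := L_eq_L_add_mul a b o τ₀ θ'
      have f3 := L_eq_L_add_mul a b t τ₀ θ'
      nlinarith [mul_nonneg (sub_nonneg.mpr hlt'.le) (sub_nonneg.mpr hθ)]
    · rcases lt_or_gt_of_ne hlt with hl' | hg'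
      · -- steeper than the floor, flatter than `λ`: the left tip `(t, o)` is a lower candidate
        have hSt : S t o := (hS t o).mpr (Or.inr (Or.inl ⟨by
          rw [Nat.odd_add']; exact ⟨fun _ => hte, fun _ => Nat.not_even_iff_odd.mp ho⟩,
          by rw [if_pos hte]; exact hgt', by rw [if_pos hte]; exact hl'⟩))
        have hm := hmin t o (Or.inl rfl) (Or.inr (Or.inr rfl)) hSt
        have hb' : L a b t τ₀ < L a b o τ₀ := by rw [hy]; exact hb
        have hcr : τ₀ < (b t - b o) / (a o - a t) := (L_lt_L_iff_lt_crossAbs a b hgt' τ₀).mp hb'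
        have e0 : (b o - b t) / (a t - a o) = (b t - b o) / (a o - a t) := crossAbs_symm a b t o
        have e1 : L a b t ((b o - b t) / (a t - a o)) = L a b o ((b o - b t) / (a t - a o)) :=
          (L_eq_L_crossAbs a b (ne_of_gt hgt')).symm
        rw [e1, e0] at hm
        have e2 := phi_along a b lam o τ₀ ((b t - b o) / (a o - a t))
        have : 0 < (lam - a o) * ((b t - b o) / (a o - a t) - τ₀) := mul_pos (by linarith) (by linarith)
        have e3 : L a b e τ₀ - lam * τ₀ = L a b o τ₀ - lam * τ₀ := by rw [hy]
        linarith
      · -- steeper than `λ`: the top corner `(e, t)` is a lower candidate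
        have hSt : S e t := (hS e t).mpr (Or.inl ⟨he, hte, Or.inl ⟨hl, hg'⟩⟩)
        have hm := hmin e t (Or.inr (Or.inl rfl)) (Or.inl rfl) hSt
        have het : a e < a t := hl.trans hg'
        have hcr : τ₀ < (b t - b e) / (a e - a t) := (L_lt_L_iff_lt_crossAbs a b het τ₀).mp hb
        have e2 := phi_along a b lam e τ₀ ((b t - b e) / (a e - a t))
        have : 0 < (lam - a e) * ((b t - b e) / (a e - a t) - τ₀) := mul_pos (by linarith) (by linarith)
        linarith
  · -- a floor above the vertex
    rcases lt_or_gt_of_ne hAte with hlt' | hgt'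
    · -- flatter than the ceiling: the left tip `(e, t)` is a lower candidate
      have hSt : S e t := (hS e t).mpr (Or.inr (Or.inl ⟨by
        rw [Nat.odd_add]; exact ⟨fun h => absurd he (Nat.not_even_iff_odd.mpr h), fun h => absurd h hto⟩,
        by rw [if_pos he]; exact hlt', by rw [if_pos he]; exact hl⟩))
      have hm := hmin e t (Or.inr (Or.inl rfl)) (Or.inl rfl) hSt
      have hcr : τ₀ < (b e - b t) / (a t - a e) := (L_lt_L_iff_lt_crossAbs a b hlt' τ₀).mp hb
      have e0 : (b t - b e) / (a e - a t) = (b e - b t) / (a t - a e) := crossAbs_symm a b e t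
      rw [e0] at hm
      have e2 := phi_along a b lam e τ₀ ((b e - b t) / (a t - a e))
      have : 0 < (lam - a e) * ((b e - b t) / (a t - a e) - τ₀) := mul_pos (by linarith) (by linarith)
      linarith
    · -- steeper than the ceiling: no point is weakly correct for `e, o, t`
      obtain ⟨θ', y', c1, c2, -, c4⟩ := hwit
      have c4' := c4 hto
      have hθ : τ₀ ≤ θ' := by rw [hτ₀']; exact (L_le_L_iff_crossAbs_le a b hs θ').mp (c2.trans c1)
      have f1 := L_eq_L_add_mul a b e τ₀ θ'
      have f3 := L_eq_L_add_mul a b t τ₀ θ'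
      nlinarith [mul_nonneg (sub_nonneg.mpr hgt'.le) (sub_nonneg.mpr hθ)]

/-- type III* step: at the vertex of a ceiling `e` of slope `> λ` flatter than the floor `o` (a right tip), if every λ-high-type pair among `t, e, o`
has functional value at least that of `(e, o)` and some point is weakly correct for `e, o, t`, then `t` is not strictly incorrect at the vertex. [folklore] -/
theorem noBadHigh_typeIII
    (hS : ∀ p q, S p q ↔
      ((Even p ∧ Even q ∧ ((a p < lam ∧ lam < a q) ∨ (a q < lam ∧ lam < a p))) ∨
       (Odd (p + q) ∧ (if Even p then a q < a p else a p < a q) ∧ (if Even p then a p else a q) < lam) ∨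
       (Odd (p + q) ∧ (if Even p then a p < a q else a q < a p) ∧ lam < (if Even p then a p else a q))))
    {e o t : ℕ} (he : Even e) (ho : ¬ Even o) (hs : a e < a o) (hl : lam < a e)
    (hAte : a t ≠ a e) (hAto : a t ≠ a o) (hlt : a t ≠ lam)
    (hbad : (Even t ∧ L a b t ((b o - b e) / (a e - a o)) < L a b e ((b o - b e) / (a e - a o))) ∨
      (¬ Even t ∧ L a b e ((b o - b e) / (a e - a o)) < L a b t ((b o - b e) / (a e - a o))))
    (hmin : ∀ x y, (x = t ∨ x = e ∨ x = o) → (y = t ∨ y = e ∨ y = o) → S x y →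
      L a b e ((b o - b e) / (a e - a o)) - lam * ((b o - b e) / (a e - a o)) ≤
        L a b x ((b y - b x) / (a x - a y)) - lam * ((b y - b x) / (a x - a y)))
    (hwit : ∃ θ' y', y' ≤ L a b e θ' ∧ L a b o θ' ≤ y' ∧ (Even t → y' ≤ L a b t θ') ∧ (¬ Even t → L a b t θ' ≤ y')) :
    False := by
  set τ₀ := (b o - b e) / (a e - a o) with hτ₀
  have hA : a e ≠ a o := ne_of_lt hs
  have hy : L a b o τ₀ = L a b e τ₀ := L_eq_L_crossAbs a b hA
  rcases hbad with ⟨hte, hb⟩ | ⟨hto, hb⟩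
  · -- a ceiling below the vertex
    rcases lt_or_gt_of_ne hAto with hlt' | hgt'
    · rcases lt_or_gt_of_ne hlt with hl' | hg'
      · -- flatter than `λ`: the top corner `(t, e)` is a lower candidate
        have hSt : S t e := (hS t e).mpr (Or.inl ⟨hte, he, Or.inl ⟨hl', hl⟩⟩)
        have hm := hmin t e (Or.inl rfl) (Or.inr (Or.inl rfl)) hSt
        have hte' : a t < a e := hl'.trans hl
        have hcr : (b e - b t) / (a t - a e) < τ₀ := (L_lt_L_iff_crossAbs_lt a b hte' τ₀).mp hb
        have e1 : L a b t ((b e - b t) / (a t - a e)) = L a b e ((b e - b t) / (a t - a e)) :=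
          (L_eq_L_crossAbs a b (ne_of_lt hte')).symm
        rw [e1] at hm
        have e2 := phi_along a b lam e τ₀ ((b e - b t) / (a t - a e))
        have : 0 < (a e - lam) * (τ₀ - (b e - b t) / (a t - a e)) := mul_pos (by linarith) (by linarith)
        linarith
      · -- between `λ` and the floor: the right tip `(t, o)` is a lower candidate
        have hSt : S t o := (hS t o).mpr (Or.inr (Or.inr ⟨by
          rw [Nat.odd_add']; exact ⟨fun _ => hte, fun _ => Nat.not_even_iff_odd.mp ho⟩,
          by rw [if_pos hte]; exact hlt', by rw [if_pos hte]; exact hg'⟩))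
        have hm := hmin t o (Or.inl rfl) (Or.inr (Or.inr rfl)) hSt
        have hb' : L a b t τ₀ < L a b o τ₀ := by rw [hy]; exact hb
        have hcr : (b o - b t) / (a t - a o) < τ₀ := (L_lt_L_iff_crossAbs_lt a b hlt' τ₀).mp hb'
        have e1 : L a b t ((b o - b t) / (a t - a o)) = L a b o ((b o - b t) / (a t - a o)) :=
          (L_eq_L_crossAbs a b (ne_of_lt hlt')).symm
        rw [e1] at hm
        have e2 := phi_along a b lam o τ₀ ((b o - b t) / (a t - a o))
        have : 0 < (a o - lam) * (τ₀ - (b o - b t) / (a t - a o)) := mul_pos (by linarith) (by linarith)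
        have e3 : L a b e τ₀ - lam * τ₀ = L a b o τ₀ - lam * τ₀ := by rw [hy]
        linarith
    · -- steeper than the floor: no point is weakly correct for `e, o, t`
      obtain ⟨θ', y', c1, c2, c3, -⟩ := hwit
      have c3' := c3 hte
      have hθ : θ' ≤ τ₀ := by rw [hτ₀]; exact (L_le_L_iff_le_crossAbs a b hs θ').mp (c2.trans c1)
      have f2 := L_eq_L_add_mul a b o τ₀ θ'
      have f3 := L_eq_L_add_mul a b t τ₀ θ'
      nlinarith [mul_nonneg_of_nonpos_of_nonpos (sub_nonpos.mpr hgt'.le) (sub_nonpos.mpr hθ)]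
  · -- a floor above the vertex
    rcases lt_or_gt_of_ne hAte with hlt' | hgt'
    · -- flatter than the ceiling: no point is weakly correct for `e, o, t`
      obtain ⟨θ', y', c1, c2, -, c4⟩ := hwit
      have c4' := c4 hto
      have hθ : θ' ≤ τ₀ := by rw [hτ₀]; exact (L_le_L_iff_le_crossAbs a b hs θ').mp (c2.trans c1)
      have f1 := L_eq_L_add_mul a b e τ₀ θ'
      have f3 := L_eq_L_add_mul a b t τ₀ θ'
      nlinarith [mul_nonneg_of_nonpos_of_nonpos (sub_nonpos.mpr hlt'.le) (sub_nonpos.mpr hθ)]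
    · -- steeper than the ceiling: the right tip `(e, t)` is a lower candidate
      have hSt : S e t := (hS e t).mpr (Or.inr (Or.inr ⟨by
        rw [Nat.odd_add]; exact ⟨fun h => absurd he (Nat.not_even_iff_odd.mpr h), fun h => absurd h hto⟩,
        by rw [if_pos he]; exact hgt', by rw [if_pos he]; exact hl⟩))
      have hm := hmin e t (Or.inr (Or.inl rfl)) (Or.inl rfl) hSt
      have hcr : (b t - b e) / (a e - a t) < τ₀ := (L_lt_L_iff_crossAbs_lt a b hgt' τ₀).mp hb
      have e2 := phi_along a b lam e τ₀ ((b t - b e) / (a e - a t))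
      have : 0 < (a e - lam) * (τ₀ - (b t - b e) / (a e - a t)) := mul_pos (by linarith) (by linarith)
      linarith

end HighTips

end

end StaticPathFold

end Summit.ValiantsHypothesis.ValiantsHypothesis.Theorems.KPlusLogSqLaw
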